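import Literature.RingTheory.CentralSimple.SkolemNoetherEmbeddings
import Literature.Geometry.Kaehler.ComplexTorusEndomorphismFieldEigenspaces
import Literature.Geometry.Kaehler.ComplexTorusEndomorphismAlgebraSemisimple
import Literature.Geometry.Kaehler.ComplexTorusVerySimpleFixedPoints
import Mathlib.NumberTheory.NumberField.CMField
import Mathlib.NumberTheory.Cyclotomic.Gal
import Mathlib.GroupTheory.Perm.Cycle.Type
import Mathlib.FieldTheory.Galois.Basic
import Mathlib.RingTheory.SimpleModule.WedderburnArtin
import Mathlib.RingTheory.SimpleRing.Congr
import Mathlib.RingTheory.SimpleRing.Matrix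
import HarnessLib

/-!
# A maximal commutative CM subfield `K ⊆ End⁰(X)`: its centre is a CM subfield, and `End⁰(X) = K`
# when every proper subfield of `K` is totally real (Zarhin, Crelle 544 (2002), Theorem 3.8, at torus level)

Layer `Literature/Geometry/Kaehler`, namespace `Literature.Geometry.Kaehler.ComplexTorus` (with a generic
algebra section `Literature.Geometry.Kaehler.MaximalSubfield` and one number-field lemma in
`Literature.NumberTheory.NumberFields`); lane `lit-hodgefound` (Track 2 foundations library), seat p11,
generation 16, row g16-#2. Sequel, BY NAME (nothing restated), of

* this seat's `Literature/RingTheory/CentralSimple/SkolemNoetherEmbeddings.lean` (g16-#1: the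
  Skolem–Noether theorem in two-homomorphism form, `exists_units_forall_algHom_algEquiv_eq_conj`);
* `ComplexTorusEndomorphismFieldEigenspaces.lean` (p13 g6-#3): for a number field
  `f : K ↪ End_ℚ(X) = endAlgRat Φ` the tangent eigenspaces
  `T_σ = ⨅_y ker(ρ_a(f y) − σ(y))` and their multiplicities `n_σ = dim_ℂ T_σ`, Moonen–Zarhin's (3),
  `iInf_eigenspace_analyticRepHom_eq_eigenspace`, `eigenspace_analyticRepHom_eq_bot`;
* `ComplexTorusEndomorphismAlgebraSemisimple.lean` (p11 g10): `End_ℚ(X)` of a polarised torus is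
  semisimple (`IsRiemannForm.isSemisimpleRing_endAlgRat`);
* `ComplexTorusVerySimpleFixedPoints.lean` / `ComplexTorusCyclotomicAutomorphismFixedPoints.lean`
  (p11 g13 / g7): `δ = D ∈ End(X)` with `Φ_ℓ(D) = 0`, `ℚ[δ] ≅ ℚ(ζ_ℓ)`, and "`ℤ[δ] = ℤ[ζ_ℓ]` is integrally
  closed" (`exists_eq_aeval_of_isIntegral`), `aeval_map_cyclotomic_eq_zero`, `mem_endRingInt_iff`.

THEOREMS ONLY (no definition, no named fact; net debt 0).

## Source, verbatim

Yu. G. Zarhin, *Cyclic covers of the projective line, their jacobians and endomorphisms*, J. reine angew.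
Math. 544 (2002) 91–110 (bib `Zarhin2002CyclicCovers`; held text `paper:arxiv-math_0008134`), §3, p0008:

"**Theorem 3.8.** Suppose `n ≥ 4` and `p > 2`. Assume that `ℚ(δ_p)` is a maximal commutative subalgebra
in `End⁰(J^{(f,p)})`. Then: (i) The center `𝒞` of `End⁰(J^{(f,p)})` is a CM-subfield of `ℚ(δ_p)`;
(ii) If `p` is a Fermat prime then `End⁰(J^{(f,p)}) = ℚ(δ_p) ≅ ℚ(ζ_p)` and therefore
`End(J^{(f,p)}) = ℤ[δ_p] ≅ ℤ[ζ_p]`.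
*Proof.* Clearly, `𝒞 ⊂ ℚ(δ_p)`. Since `ℚ(δ_p)` is a CM-field, `𝒞` is either a totally real field or a
CM-field. If `p` is a Fermat prime then each subfield of `ℚ(δ_p)` (distinct from `ℚ(δ_p)` itself) is
totally real. Therefore, (ii) follows from (i). In order to prove (i), let us assume that `𝒞` is totally
real. We are going to arrive to a contradiction which proves (i). […] Since the center `𝒞` of
`End⁰(J^{f,p})` is totally real, the Hodge group of `J^{(f,p)}` must be semisimple. This implies that the
pair `(J^{(f,p)}, ℚ(δ_p))` is of Weil type ([MZ]), i.e., `ℚ(δ_p)` acts on `Ω¹(J^{(f,p)})` in such a way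
that for each embedding `σ : ℚ(δ_p) ↪ ℂ` the corresponding multiplicity
`n_σ = dim(J^{(f,p)})/[ℚ(δ_p):ℚ]`. Now assume that `p` does not divide `n`. […] Elementary calculations
([Koo], Th. 3 on p. 403) show that for all integers `i` with `0 ≤ i ≤ n−1−(n+1)/p` the differentials
`x^i dx/y^{p−1} ∈ Ω¹(C_{f,p})`; clearly, they constitute a set of `K_a`-linearly independent eigenvectors
of `δ_p` with eigenvalue `ζ`. […] we conclude that `(n−1)/2 = n_σ ≥ [n−1−(n+1)/p]+1`. […] This gives us
the desired contradiction".

And §1, p0001: "Recall that `p` is called a Fermat prime if `p = 2^{2^r}+1` […] If `p` is a Fermat prime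
then the only CM-subfield of `ℚ(ζ_p)` is `ℚ(ζ_p)` itself, since the Galois group of `ℚ(ζ_p)/ℚ` is a
cyclic `2`-group, whose only element of order `2` acts as the complex conjugation. All other subfields of
`ℚ(ζ_p)` are totally real."  (Used in the second clause of **Theorem 1.1**: "If `p` is a Fermat prime
[…] then `End(J^{(f,p)}) = ℤ[δ_p] ≅ ℤ[ζ_p]`.")

## Statement formalised (torus level) and the deviations

`X = E/Φ(ℤ^ι)` a complex torus with a polarisation `η` (`IsRiemannForm Φ η`; the Jacobian is
canonically polarised), `K` a number field with an embedding `f : K →ₐ[ℚ] M_ι(ℚ)` into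
`End⁰(X) = endAlgRat Φ` (the convention of p13's eigenspace file), assumed MAXIMAL COMMUTATIVE in the
self-centralising form `∀ B ∈ End⁰(X), (∀ k, B f(k) = f(k) B) → B ∈ f(K)` (for a commutative subalgebra
"maximal commutative" and "equal to its own centraliser" are the same thing: a strictly larger commutant
element `a` would give the commutative `K[a] ⊋ K`). Consequently the centre `𝒞 = Z(End⁰(X))` lies in
`f(K)`; "`f(k)` is central" is written `∀ B ∈ endAlgRat Φ, B * f k = f k * B`, "`𝒞` is totally real" as
"every such `k` lies in the maximal real subfield `K⁺ = NumberField.maximalRealSubfield K`" (Mathlib's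
`IsCMField`, `complexConj`, `complexConj_eq_self_iff`), and the tangent multiplicity `n_σ` of an
embedding `σ : K ↪ ℂ` is p13's `finrank ℂ ↥(⨅ y, eigenspace (ρ_a (f y)) (σ y))`.

* **(i), Weil-type form** `finrank_iInf_eigenspace_analyticRepHom_conjugate_eq_of_center_real`: if `𝒞`
  is totally real then `n_σ̄ = n_σ` for every `σ` — "the pair `(J, ℚ(δ_p))` is of Weil type" (with
  `n_σ + n_σ̄ = 2 dim X/[K:ℚ]` of p13's file this is the printed `n_σ = dim(J)/[ℚ(δ_p):ℚ]`).
  **(i) as printed, contrapositively** (`exists_center_not_mem_maximalRealSubfield`,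
  `exists_center_complexConj_ne`): if ONE pair `n_σ ≠ n_σ̄` — on the Jacobian of `y^p = f(x)` this is
  the eigenvector count of [Koo], Th. 3, a curve-side input OUTSIDE the torus model, taken here as the
  hypothesis exactly as this seat's `ComplexTorusVerySimpleFixedPointsEigenvalues.lean` did — then the
  centre is NOT totally real: some central `f(k)` has `k ∉ K⁺`, `k̄ ≠ k` ("`𝒞` is a CM-subfield").
* **(ii)** `endAlgRat_le_range_of_forall_intermediateField` (engine: if every proper subfield of `K` is
  totally real then `End⁰(X) = f(K)` — "Therefore, (ii) follows from (i)"),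
  `Literature.NumberTheory.NumberFields.forall_mem_maximalRealSubfield_of_ne_top_of_fermatPrime` (the
  §1 sentence: for `p = 2^{2^r}+1` prime every intermediate field `F ≠ ℚ(ζ_p)` of a `p`-th cyclotomic
  field lies in `ℚ(ζ_p)⁺`, by Cauchy's theorem in the non-trivial `2`-group `Gal(ℚ(ζ_p)/F)` and the
  uniqueness of the involution `−1` of `(ℤ/p)^× ≅ Gal(ℚ(ζ_p)/ℚ)` (Mathlib `autEquivPow`)),
  `endAlgRat_le_range_of_fermatPrime` (**(ii) for `K ≅ ℚ(ζ_p)`**, any `IsCyclotomicExtension {p} ℚ K`),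
  and `endRingInt_le_adjoin_of_fermatPrime` (**(ii) in the `δ`-language of this seat's gen 7–13 files**:
  `D ∈ End(X)`, `Φ_p(D) = 0`, `ℚ[δ]` self-centralising in `End⁰(X)`, one eigenvalue `μ` of `ρ_a(δ)` with
  `mult(μ) ≠ mult(μ̄)` ⟹ `End⁰(X) = ℚ[δ]` AND "therefore `End(X) = ℤ[δ]`", the cyclotomic field being
  realised as `CyclotomicField p ℚ`, `ζ_p ↦ δ` by `PowerBasis.lift`).
* **The multiplicities are invariant under `Aut(K/𝒞)`** (`finrank_iInf_eigenspace_analyticRepHom_comp_algEquiv`,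
  the engine of (i)): for ANY number field `K` maximal commutative in `End⁰(X)` and any
  `ℚ`-automorphism `τ` of `K` fixing the (pull-back of the) centre pointwise, `n_{σ∘τ} = n_σ`.

DEVIATION FROM THE PRINTED PROOF OF (i) (a shorter road on the same objects, recorded here as the lane
rules require). The print argues: `𝒞` totally real ⟹ Hodge group semisimple ⟹ `(J, ℚ(δ_p))` of Weil type
by Moonen–Zarhin [MZ]. We replace this by pure algebra: `End⁰(X)` is semisimple (Poincaré–Lange Cor. 2.4.26,
p11 g10) with centre `𝒞 ⊆ f(K)` a field, hence CENTRAL SIMPLE over `𝒞`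
(`MaximalSubfield.isSimpleRing_of_centralizer_le`, via Wedderburn–Artin: a non-trivial central idempotent
would lie in the field `f(K)`); if `𝒞 ⊆ K⁺` then complex conjugation `k ↦ k̄` is `𝒞`-linear, so by
SKOLEM–NOETHER over `𝒞` (g16-#1, Voight Main Thm. 7.7.1) there is `u ∈ End⁰(X)^×` with
`f(k̄) = u f(k) u⁻¹` (`MaximalSubfield.exists_units_forall_algHom_algEquiv_eq_conj_of_centralizer_le`);
then `ρ_a(u)` maps `T_σ` injectively into `T_σ̄` (`MaximalSubfield.finrank_iInf_eigenspace_le_of_units_conj`),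
whence `n_σ ≤ n_σ̄` and, symmetrically, equality. No Hodge group is needed; the conclusion is the printed
one. (The printed proof's last step — the contradiction with [Koo]'s eigenvectors — is curve geometry and
enters as the hypothesis `n_σ ≠ n_σ̄`, resp. `mult(μ) ≠ mult(μ̄)`.)

NOT HERE: the curve `y^p = f(x)` and [Koo] Th. 3; Theorem 3.8's "`n ≥ 4`, `p > 2`" (curve-side); the
statement "`𝒞` is a CM field" as Mathlib's `IsCMField ↥𝒞` (we prove the printed dichotomy's content:
`𝒞 ⊄ K⁺`, `k̄ ≠ k` on `𝒞`); Remark 3.9 / Ribet's theorem on the Hodge group of `J^{(f,3)}`.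

## References

* [Zarhin2002CyclicCovers] Yu. G. Zarhin, Cyclic covers of the projective line, their jacobians and
  endomorphisms, J. reine angew. Math. 544 (2002), §1 (p0001), §3 Thm. 3.8 and proof (p0008).
* [Voight2021] J. Voight, Quaternion Algebras, GTM 288 (2021), §7.7 Main Thm. 7.7.1 (PDF p0127).
* [MoonenZarhin1998WeilClasses] B. Moonen, Yu. Zarhin, Weil classes on abelian varieties, J. reine angew.
  Math. 496 (1998), (3), (5) (the multiplicities `n_σ`, Weil type `n_σ = n_σ̄`).
* [Shimura1998] G. Shimura, Abelian Varieties with Complex Multiplication and Modular Functions (1998),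
  §5.1 Prop. 4 and proof (the centre of `End_ℚ(A)`; `End_ℚ(A)` central simple over it).
* [Cohn2000IntroductionRingTheory] P. M. Cohn, Introduction to Ring Theory (2000), §2.3 Ex. 5–6, §4.1
  Thm. 4.2 (central idempotents; "`R` is simple iff the centre of `R` is a field").
* [Lange2023AbelianVarietiesComplex] H. Lange, Abelian Varieties over the Complex Numbers (2023), §2.4.4
  Cor. 2.4.26 (`End_ℚ(X)` semisimple).
-/

noncomputable section

open Module Polynomial NumberField
open scoped ComplexConjugate IntermediateField

universe u

/-! ## §1 Generic algebra: a semisimple algebra whose central idempotents are trivial is simple;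
Skolem–Noether over the centre for a maximal commutative subfield; conjugate operators have
eigenspaces of the same dimension -/

namespace Literature.Geometry.Kaehler

namespace MaximalSubfield

/-- **A semisimple ring whose only central idempotents are `0` and `1` is simple** (Wedderburn–Artin:
`A ≅ Π_i M_{d_i}(D_i)`; with two factors, `(1, 0, …)` is a central idempotent `≠ 0, 1`).
[cite: Shimura1998, §5.1 proof of Prop. 4 ("`End_ℚ(A)` is a central simple algebra over `K`")]
[cite: Cohn2000IntroductionRingTheory, §2.3 Exercises 5–6 (solution p. 183) and §4.1 Thm. 4.2] -/
theorem isSimpleRing_of_forall_central_idempotent {A : Type u} [Ring A] [IsSemisimpleRing A]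
    [Nontrivial A]
    (h : ∀ e : A, IsIdempotentElem e → (∀ a : A, a * e = e * a) → e = 0 ∨ e = 1) :
    IsSimpleRing A := by
  classical
  obtain ⟨n, D, d, _, hd, ⟨e⟩⟩ := IsSemisimpleRing.exists_ringEquiv_pi_matrix_divisionRing A
  -- at least one factor
  have hn : n ≠ 0 := by
    rintro rfl
    haveI : Subsingleton (Π i : Fin 0, Matrix (Fin (d i)) (Fin (d i)) (D i)) := inferInstance
    exact not_subsingleton A e.injective.subsingleton
  -- at most one factor: otherwise `e⁻¹(1, 0, …, 0)` is a central idempotent `≠ 0, 1`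
  have hsub : ∀ i j : Fin n, i = j := by
    intro i j
    by_contra hij
    let s : Π k : Fin n, Matrix (Fin (d k)) (Fin (d k)) (D k) := Pi.single i 1
    have hs : ∀ k, s k = if k = i then 1 else 0 := fun k ↦ by
      by_cases hk : k = i
      · subst hk; simp [s]
      · simp [s, hk]
    let z : A := e.symm s
    have hz : IsIdempotentElem z := by
      change e.symm s * e.symm s = e.symm s
      rw [← map_mul]
      congr 1
      funext k
      rw [Pi.mul_apply, hs]
      split_ifs <;> simp
    have hc : ∀ a : A, a * z = z * a := by
      intro a
      apply e.injective
      rw [map_mul, map_mul]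
      change e a * e (e.symm s) = e (e.symm s) * e a
      rw [e.apply_symm_apply]
      funext k
      rw [Pi.mul_apply, Pi.mul_apply, hs]
      split_ifs <;> simp
    rcases h z hz hc with h0 | h1
    · -- `s i = 1 ≠ 0`
      have h0' : s = 0 := by
        have := congrArg e h0
        rwa [show e z = s from e.apply_symm_apply s, map_zero] at this
      have hi := congrFun h0' i
      rw [hs, if_pos rfl, Pi.zero_apply] at hi
      haveI : NeZero (d i) := hd i
      exact one_ne_zero hi
    · -- `s j = 0 ≠ 1`
      have h1' : s = 1 := by
        have := congrArg e h1
        rwa [show e z = s from e.apply_symm_apply s, map_one] at this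
      have hj := congrFun h1' j
      rw [hs, if_neg (Ne.symm hij), Pi.one_apply] at hj
      haveI : NeZero (d j) := hd j
      exact zero_ne_one hj
  haveI : Unique (Fin n) := ⟨⟨⟨0, Nat.pos_of_ne_zero hn⟩⟩, fun i ↦ hsub _ _⟩
  haveI : NeZero (d default) := hd default
  exact IsSimpleRing.of_ringEquiv
    (e.trans (RingEquiv.piUnique fun k : Fin n ↦ Matrix (Fin (d k)) (Fin (d k)) (D k))).symm
    inferInstance

/-- If a field `K` is embedded in a semisimple algebra `A` as a maximal commutative subalgebra, then the
only central idempotents of `A` are `0, 1` (they lie in `f(K)`), so `A` is simple ("`K` is the center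
of `End_ℚ(A)` … a central simple algebra"). [cite: Shimura1998, §5.1 proof of Prop. 4 (pp. 48–49)] -/
theorem isSimpleRing_of_centralizer_le {F₀ : Type*} [Field F₀] {A : Type u} [Ring A] [Algebra F₀ A]
    [IsSemisimpleRing A] [Nontrivial A] {K : Type*} [Field K] [Algebra F₀ K] (f : K →ₐ[F₀] A)
    (hmax : ∀ a : A, (∀ k, a * f k = f k * a) → a ∈ Set.range f) : IsSimpleRing A := by
  refine isSimpleRing_of_forall_central_idempotent fun z hz hc ↦ ?_
  obtain ⟨k, rfl⟩ := hmax z fun k ↦ (hc (f k)).symm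
  have hk : k * k = k := (f : K →+* A).injective (by rw [map_mul]; exact hz)
  rcases eq_or_ne k 0 with h | h
  · exact Or.inl (by rw [h, map_zero])
  · refine Or.inr ?_
    have h1 : k = 1 := mul_left_cancel₀ h (by rw [hk, mul_one])
    rw [h1, map_one]

/-- **Skolem–Noether over the centre, for a maximal commutative subfield.** Let `A` be a
finite-dimensional semisimple `F₀`-algebra and `f : K ↪ A` a field embedded as a MAXIMAL COMMUTATIVE
subalgebra (everything commuting with `f(K)` lies in `f(K)`); then the centre `Z(A)` lies in `f(K)`,
`A` is central simple over the field `C = f⁻¹Z(A)`, and every automorphism `τ` of `K` fixing `C`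
pointwise is induced by an inner automorphism of `A`: `f(τ k) = u f(k) u⁻¹` (Voight's Main Theorem
7.7.1 over `F = C`, through this seat's `exists_units_forall_algHom_algEquiv_eq_conj`).
[cite: Voight2021, §7.7 Main Thm. 7.7.1 and Cor. 7.7.2 (PDF p0127)]
[cite: Shimura1998, §5.1 proof of Prop. 4 ("`K` is the center of `End_ℚ(A)` … `End_ℚ(A)` is a central simple algebra over `K`", pp. 48–49)] -/
theorem exists_units_forall_algHom_algEquiv_eq_conj_of_centralizer_le {F₀ : Type*} [Field F₀]
    {A : Type u} [Ring A] [Algebra F₀ A] [FiniteDimensional F₀ A] [IsSemisimpleRing A]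
    {K : Type*} [Field K] [Algebra F₀ K] [FiniteDimensional F₀ K] (f : K →ₐ[F₀] A)
    (hmax : ∀ a : A, (∀ k, a * f k = f k * a) → a ∈ Set.range f) (τ : K ≃ₐ[F₀] K)
    (hτ : ∀ k : K, (∀ a : A, a * f k = f k * a) → τ k = k) :
    ∃ u : Aˣ, ∀ k : K, f (τ k) = u * f k * ↑u⁻¹ := by
  classical
  rcases subsingleton_or_nontrivial A with hA | hA
  · exact ⟨1, fun k ↦ Subsingleton.elim _ _⟩
  -- the centre, pulled back to `K`: a subfield `C`
  let C₀ : Subalgebra F₀ K := (Subalgebra.center F₀ A).comap f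
  have hC₀ : ∀ k : K, k ∈ C₀ ↔ ∀ a : A, a * f k = f k * a := fun k ↦ by
    change f k ∈ Subalgebra.center F₀ A ↔ _
    exact Subalgebra.mem_center_iff
  haveI : Algebra.IsAlgebraic F₀ K := Algebra.IsAlgebraic.of_finite F₀ K
  let C : IntermediateField F₀ K := C₀.toIntermediateField' (Subalgebra.isField_of_algebraic C₀)
  have hC : ∀ k : K, k ∈ C ↔ ∀ a : A, a * f k = f k * a := fun k ↦ by
    rw [← hC₀]; exact Iff.rfl
  -- `A` as a `C`-algebra through `f`
  letI : Algebra C A := ((f : K →+* A).comp (algebraMap C K)).toAlgebra' fun c x ↦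
    (((hC (c : K)).1 c.2) x).symm
  have halg : ∀ c : C, algebraMap C A c = f (c : K) := fun c ↦ rfl
  haveI : IsScalarTower F₀ C A := IsScalarTower.of_algebraMap_eq fun r ↦ by
    rw [halg]
    change algebraMap F₀ A r = f (algebraMap F₀ K r)
    rw [AlgHom.commutes]
  haveI : Module.Finite C A := Module.Finite.of_restrictScalars_finite F₀ C A
  haveI : IsSimpleRing A := isSimpleRing_of_centralizer_le f hmax
  haveI : Algebra.IsCentral C A := ⟨fun z hz ↦ by
    rw [Subalgebra.mem_center_iff] at hz
    obtain ⟨k, rfl⟩ := hmax z fun k ↦ (hz (f k)).symm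
    exact Algebra.mem_bot.2 ⟨⟨k, (hC k).2 hz⟩, rfl⟩⟩
  -- `f` and `τ` are `C`-linear
  let fC : K →ₐ[C] A := { (f : K →+* A) with commutes' := fun c ↦ rfl }
  let τC : K ≃ₐ[C] K :=
    { τ.toRingEquiv with commutes' := fun c ↦ hτ (c : K) ((hC (c : K)).1 c.2) }
  obtain ⟨u, hu⟩ :=
    Literature.RingTheory.CentralSimple.exists_units_forall_algHom_algEquiv_eq_conj fC τC
  exact ⟨u, fun k ↦ hu k⟩

/-- **Conjugate operators have equidimensional joint eigenspaces**: if `f₂(y) u = u f₁(y)` for a unit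
`u`, then `g(u)` maps `⋂_y ker(g(f₁ y) − c_y)` injectively into `⋂_y ker(g(f₂ y) − c_y)`, so the first
has dimension at most the second (the linear-algebra step "`φ` […] commutes with the natural actions",
proof of Thm. 3.6). [cite: Zarhin2002CyclicCovers, §3 proof of Thm 3.6 (p0007)] -/
theorem finrank_iInf_eigenspace_le_of_units_conj {A : Type*} [Ring A] {L W : Type*} [Field L]
    [AddCommGroup W] [Module L W] [FiniteDimensional L W] (g : A →+* Module.End L W) (u : Aˣ)
    {Y : Type*} (f₁ f₂ : Y → A) (h : ∀ y, f₂ y * u = u * f₁ y) (c : Y → L) :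
    finrank L ↥(⨅ y, Module.End.eigenspace (g (f₁ y)) (c y)) ≤
      finrank L ↥(⨅ y, Module.End.eigenspace (g (f₂ y)) (c y)) := by
  set T₁ := ⨅ y, Module.End.eigenspace (g (f₁ y)) (c y) with hT₁
  set T₂ := ⨅ y, Module.End.eigenspace (g (f₂ y)) (c y) with hT₂
  have hmap : ∀ v ∈ T₁, g (u : A) v ∈ T₂ := by
    intro v hv
    rw [hT₁, Submodule.mem_iInf] at hv
    rw [hT₂, Submodule.mem_iInf]
    intro y
    rw [Module.End.mem_eigenspace_iff, ← Module.End.mul_apply, ← map_mul, h y, map_mul,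
      Module.End.mul_apply, (Module.End.mem_eigenspace_iff).1 (hv y), map_smul]
  let φ : T₁ →ₗ[L] T₂ := LinearMap.codRestrict T₂ ((g (u : A)).comp T₁.subtype) fun v ↦ hmap v v.2
  have hinj : Function.Injective φ := by
    intro v w hvw
    apply Subtype.ext
    have h1 : g (u : A) (v : W) = g (u : A) (w : W) := congrArg Subtype.val hvw
    have h2 := congrArg (g (↑u⁻¹ : A)) h1
    rwa [← Module.End.mul_apply, ← map_mul, Units.inv_mul, map_one, Module.End.one_apply,
      ← Module.End.mul_apply, ← map_mul, Units.inv_mul, map_one, Module.End.one_apply] at h2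
  exact LinearMap.finrank_le_finrank_of_injective hinj

end MaximalSubfield

/-! ## §2 Torus level: Theorem 3.8 (i) — a maximal commutative CM subfield `K ⊆ End⁰(X)` whose
centre is totally real forces `n_σ = n_σ̄`; contrapositively the centre is a CM subfield -/

namespace ComplexTorus

open MaximalSubfield

variable {ι : Type*} [Fintype ι] [DecidableEq ι] {E : Type*} [NormedAddCommGroup E] [NormedSpace ℂ E]
  [FiniteDimensional ℂ E] (Φ : (ι → ℝ) ≃L[ℝ] E) {η : E [⋀^Fin 2]→L[ℝ] ℝ}
  {K : Type*} [Field K] [NumberField K] (f : K →ₐ[ℚ] Matrix ι ι ℚ) (hf : ∀ x, f x ∈ endAlgRat Φ)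

/-- **The tangent multiplicities are invariant under the automorphisms of `K` over the centre.**
For a polarised complex torus `(X, η)` and a number field `f : K ↪ End⁰(X)` embedded as a MAXIMAL
COMMUTATIVE subalgebra, every `ℚ`-automorphism `τ` of `K` fixing (the pull-back of) the centre
`Z(End⁰(X)) ⊆ f(K)` pointwise preserves the multiplicities: `n_{σ ∘ τ} = n_σ` for every embedding
`σ : K ↪ ℂ` — Skolem–Noether over the centre gives `u ∈ End⁰(X)^×` with `f(τk) = u f(k) u⁻¹`, and
`ρ_a(u)` carries `T_σ` onto `T_{σ∘τ⁻¹}`. (The algebraic mechanism behind "the Hodge group of `J` must be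
semisimple. This implies that the pair `(J, ℚ(δ_p))` is of Weil type", proof of Thm. 3.8.)
[cite: Zarhin2002CyclicCovers, §3 Thm 3.8 (i), proof (p0008)] [cite: Voight2021, §7.7 Main Thm. 7.7.1 (PDF p0127)] -/
theorem finrank_iInf_eigenspace_analyticRepHom_comp_algEquiv (hη : IsRiemannForm Φ η)
    (hmax : ∀ B ∈ endAlgRat Φ, (∀ k, B * f k = f k * B) → B ∈ Set.range f) (τ : K ≃ₐ[ℚ] K)
    (hτ : ∀ k : K, (∀ B ∈ endAlgRat Φ, B * f k = f k * B) → τ k = k) (σ : K →+* ℂ) :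
    finrank ℂ ↥(⨅ y : K, Module.End.eigenspace
        ((analyticRepHom Φ ⟨f y, hf y⟩ : E →L[ℂ] E) : E →ₗ[ℂ] E) (σ.comp (τ : K →+* K) y)) =
      finrank ℂ ↥(⨅ y : K, Module.End.eigenspace
        ((analyticRepHom Φ ⟨f y, hf y⟩ : E →L[ℂ] E) : E →ₗ[ℂ] E) (σ y)) := by
  classical
  haveI : IsSemisimpleRing (endAlgRat Φ) := hη.isSemisimpleRing_endAlgRat
  -- `f` with values in the subalgebra `End_ℚ(X)` and the analytic representation on it
  let f' : K →ₐ[ℚ] endAlgRat Φ := f.codRestrict (endAlgRat Φ) hf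
  let g : endAlgRat Φ →+* Module.End ℂ E :=
    ContinuousLinearMap.toLinearMapRingHom.comp (analyticRepHom Φ)
  have hg : ∀ y : K, g (f' y) = ((analyticRepHom Φ ⟨f y, hf y⟩ : E →L[ℂ] E) : E →ₗ[ℂ] E) :=
    fun y ↦ rfl
  have hmax' : ∀ a : endAlgRat Φ, (∀ k, a * f' k = f' k * a) → a ∈ Set.range f' := by
    intro a ha
    obtain ⟨k, hk⟩ := hmax a.1 a.2 fun k ↦ congrArg Subtype.val (ha k)
    exact ⟨k, Subtype.ext hk⟩
  have hcen : ∀ (ψ : K ≃ₐ[ℚ] K), (∀ k : K, (∀ B ∈ endAlgRat Φ, B * f k = f k * B) → ψ k = k) →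
      ∀ k : K, (∀ a : endAlgRat Φ, a * f' k = f' k * a) → ψ k = k :=
    fun ψ hψ k hk ↦ hψ k fun B hB ↦ congrArg Subtype.val (hk ⟨B, hB⟩)
  -- one inequality for every admissible automorphism
  have hle : ∀ (ψ : K ≃ₐ[ℚ] K), (∀ k : K, (∀ B ∈ endAlgRat Φ, B * f k = f k * B) → ψ k = k) →
      ∀ φ : K →+* ℂ,
      finrank ℂ ↥(⨅ y : K, Module.End.eigenspace (g (f' y)) (φ y)) ≤
        finrank ℂ ↥(⨅ y : K, Module.End.eigenspace (g (f' y)) (φ.comp (ψ.symm : K →+* K) y)) := by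
    intro ψ hψ φ
    obtain ⟨u, hu⟩ :=
      exists_units_forall_algHom_algEquiv_eq_conj_of_centralizer_le f' hmax' ψ (hcen ψ hψ)
    have h := finrank_iInf_eigenspace_le_of_units_conj g u (fun y ↦ f' y) (fun y ↦ f' (ψ y))
      (fun y ↦ by rw [hu y, Units.inv_mul_cancel_right]) φ
    -- reindex the second intersection along `ψ`
    let G : K → Submodule ℂ E := fun y ↦
      Module.End.eigenspace (g (f' y)) (φ.comp (ψ.symm : K →+* K) y)
    have hre : (⨅ y : K, Module.End.eigenspace (g (f' (ψ y))) (φ y)) =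
        ⨅ y : K, Module.End.eigenspace (g (f' y)) (φ.comp (ψ.symm : K →+* K) y) := by
      calc (⨅ y : K, Module.End.eigenspace (g (f' (ψ y))) (φ y))
          = ⨅ y : K, G ((ψ : K ≃ K) y) := iInf_congr fun y ↦ by
            change Module.End.eigenspace (g (f' (ψ y))) (φ y) =
              Module.End.eigenspace (g (f' (ψ y))) (φ (ψ.symm (ψ y)))
            rw [ψ.symm_apply_apply]
        _ = ⨅ y : K, G y := Equiv.iInf_comp (ψ : K ≃ K)
    rwa [hre] at h
  have hτ' : ∀ k : K, (∀ B ∈ endAlgRat Φ, B * f k = f k * B) → τ.symm k = k := by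
    intro k hk
    conv_lhs => rw [← hτ k hk]
    exact τ.symm_apply_apply k
  -- the multiplicities through `g ∘ f'`
  have key : ∀ φ : K →+* ℂ,
      finrank ℂ ↥(⨅ y : K, Module.End.eigenspace
        ((analyticRepHom Φ ⟨f y, hf y⟩ : E →L[ℂ] E) : E →ₗ[ℂ] E) (φ y)) =
      finrank ℂ ↥(⨅ y : K, Module.End.eigenspace (g (f' y)) (φ y)) := fun φ ↦ rfl
  rw [key (σ.comp (τ : K →+* K)), key σ]
  apply le_antisymm
  · -- `n_{σ∘τ} ≤ n_{σ∘τ∘τ⁻¹} = n_σ`, with `ψ = τ`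
    refine (hle τ hτ (σ.comp (τ : K →+* K))).trans (le_of_eq ?_)
    refine congrArg (fun S : Submodule ℂ E ↦ finrank ℂ ↥S) (iInf_congr fun y ↦ ?_)
    change Module.End.eigenspace (g (f' y)) (σ (τ (τ.symm y))) = _
    rw [τ.apply_symm_apply]
  · -- `n_σ ≤ n_{σ∘(τ⁻¹)⁻¹} = n_{σ∘τ}`, with `ψ = τ⁻¹`
    refine (hle τ.symm hτ' σ).trans (le_of_eq ?_)
    refine congrArg (fun S : Submodule ℂ E ↦ finrank ℂ ↥S) (iInf_congr fun y ↦ ?_)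
    change Module.End.eigenspace (g (f' y)) (σ (τ.symm.symm y)) = _
    rw [τ.symm_symm]
    rfl


/-- **Theorem 3.8 (i), Weil-type form.** Let `(X, η)` be a polarised complex torus and `K` a CM field
embedded in `End⁰(X)` as a MAXIMAL COMMUTATIVE subalgebra (so the centre `𝒞 = Z(End⁰(X))` lies in
`f(K)`). If `𝒞` is totally real — every `k ∈ K` with `f(k)` central lies in the maximal real subfield
`K⁺` — then `(X, K)` is of Weil type: `n_σ̄ = n_σ` for every embedding `σ : K ↪ ℂ` ("Since the center
`𝒞` of `End⁰(J^{f,p})` is totally real, the Hodge group of `J^{(f,p)}` must be semisimple. This implies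
that the pair `(J^{(f,p)}, ℚ(δ_p))` is of Weil type ([MZ]), i.e. […] for each embedding
`σ : ℚ(δ_p) ↪ ℂ` the corresponding multiplicity `n_σ = dim(J^{(f,p)})/[ℚ(δ_p):ℚ]`" — here by the
shorter algebraic road: complex conjugation is then linear over the centre, hence inner on `End⁰(X)` by
Skolem–Noether, and `ρ_a` of the conjugator exchanges `T_σ` and `T_σ̄`).
[cite: Zarhin2002CyclicCovers, §3 Thm 3.8 (i) and its proof (p0008)] [cite: MoonenZarhin1998WeilClasses, (3), (5) (Weil type: `n_σ = n_σ̄`)] -/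
theorem finrank_iInf_eigenspace_analyticRepHom_conjugate_eq_of_center_real [IsCMField K]
    (hη : IsRiemannForm Φ η)
    (hmax : ∀ B ∈ endAlgRat Φ, (∀ k, B * f k = f k * B) → B ∈ Set.range f)
    (hreal : ∀ k : K, (∀ B ∈ endAlgRat Φ, B * f k = f k * B) → k ∈ maximalRealSubfield K)
    (σ : K →+* ℂ) :
    finrank ℂ ↥(⨅ y : K, Module.End.eigenspace
        ((analyticRepHom Φ ⟨f y, hf y⟩ : E →L[ℂ] E) : E →ₗ[ℂ] E)
          (NumberField.ComplexEmbedding.conjugate σ y)) =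
      finrank ℂ ↥(⨅ y : K, Module.End.eigenspace
        ((analyticRepHom Φ ⟨f y, hf y⟩ : E →L[ℂ] E) : E →ₗ[ℂ] E) (σ y)) := by
  -- complex conjugation of the CM field `K`, as a `ℚ`-automorphism
  let τ : K ≃ₐ[ℚ] K := AlgEquiv.ofRingEquiv (f := (IsCMField.complexConj K).toRingEquiv) fun q ↦ by
    change IsCMField.complexConj K ((q : ℚ) : K) = ((q : ℚ) : K)
    exact map_ratCast _ q
  have hτ : ∀ x, τ x = IsCMField.complexConj K x := fun x ↦ rfl
  have hτc : ∀ k : K, (∀ B ∈ endAlgRat Φ, B * f k = f k * B) → τ k = k := fun k hk ↦ by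
    rw [hτ, IsCMField.complexConj_eq_self_iff]
    exact hreal k hk
  have hconj : NumberField.ComplexEmbedding.conjugate σ = σ.comp (τ : K →+* K) := by
    ext x
    change NumberField.ComplexEmbedding.conjugate σ x = σ (τ x)
    rw [NumberField.ComplexEmbedding.conjugate_coe_eq, hτ, IsCMField.complexEmbedding_complexConj]
  rw [hconj]
  exact finrank_iInf_eigenspace_analyticRepHom_comp_algEquiv Φ f hf hη hmax τ hτc σ

/-- **Theorem 3.8 (i) as printed (torus level): "the center `𝒞` of `End⁰` is a CM-subfield of
`ℚ(δ_p)`" — it is NOT totally real.** For a polarised complex torus `(X, η)` with a CM field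
`f : K ↪ End⁰(X)` maximal commutative, if some tangent multiplicity differs from its conjugate
(`n_σ ≠ n_σ̄`; on the Jacobian of `y^p = f(x)` this is the eigenvector count of [Koo], Th. 3 — the
curve-side input of the printed proof, taken here as the hypothesis), then some CENTRAL element `f(k)`
has `k ∉ K⁺`: the centre `𝒞 ⊆ f(K)` is not a totally real field.
[cite: Zarhin2002CyclicCovers, §3 Thm 3.8 (i) (p0008)] -/
theorem exists_center_not_mem_maximalRealSubfield [IsCMField K] (hη : IsRiemannForm Φ η)
    (hmax : ∀ B ∈ endAlgRat Φ, (∀ k, B * f k = f k * B) → B ∈ Set.range f)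
    (hne : ∃ σ : K →+* ℂ,
      finrank ℂ ↥(⨅ y : K, Module.End.eigenspace
          ((analyticRepHom Φ ⟨f y, hf y⟩ : E →L[ℂ] E) : E →ₗ[ℂ] E) (σ y)) ≠
        finrank ℂ ↥(⨅ y : K, Module.End.eigenspace
          ((analyticRepHom Φ ⟨f y, hf y⟩ : E →L[ℂ] E) : E →ₗ[ℂ] E)
            (NumberField.ComplexEmbedding.conjugate σ y))) :
    ∃ k : K, (∀ B ∈ endAlgRat Φ, B * f k = f k * B) ∧ k ∉ maximalRealSubfield K := by
  by_contra h
  push Not at h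
  obtain ⟨σ, hσ⟩ := hne
  exact hσ (finrank_iInf_eigenspace_analyticRepHom_conjugate_eq_of_center_real Φ f hf hη hmax h σ).symm

/-- Theorem 3.8 (i), the same conclusion through the complex conjugation of `K`: some central `f(k)`
has `k̄ ≠ k` (complex conjugation acts non-trivially on the centre `𝒞`, "`𝒞` is […] a CM-field", not
totally real). [cite: Zarhin2002CyclicCovers, §3 Thm 3.8 (i) and its proof ("`𝒞` is either a totally real field or a CM-field", p0008)] -/
theorem exists_center_complexConj_ne [IsCMField K] (hη : IsRiemannForm Φ η)
    (hmax : ∀ B ∈ endAlgRat Φ, (∀ k, B * f k = f k * B) → B ∈ Set.range f)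
    (hne : ∃ σ : K →+* ℂ,
      finrank ℂ ↥(⨅ y : K, Module.End.eigenspace
          ((analyticRepHom Φ ⟨f y, hf y⟩ : E →L[ℂ] E) : E →ₗ[ℂ] E) (σ y)) ≠
        finrank ℂ ↥(⨅ y : K, Module.End.eigenspace
          ((analyticRepHom Φ ⟨f y, hf y⟩ : E →L[ℂ] E) : E →ₗ[ℂ] E)
            (NumberField.ComplexEmbedding.conjugate σ y))) :
    ∃ k : K, (∀ B ∈ endAlgRat Φ, B * f k = f k * B) ∧ IsCMField.complexConj K k ≠ k := by
  obtain ⟨k, hk, hk'⟩ := exists_center_not_mem_maximalRealSubfield Φ f hf hη hmax hne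
  exact ⟨k, hk, fun h ↦ hk' ((IsCMField.complexConj_eq_self_iff K k).1 h)⟩

/-- **Theorem 3.8 (ii), engine: if every proper subfield of `K` is totally real then
`End⁰(X) = f(K)`.** ("If `p` is a Fermat prime then each subfield of `ℚ(δ_p)` (distinct from `ℚ(δ_p)`
itself) is totally real. Therefore, (ii) follows from (i)": the centre `𝒞 ⊆ f(K)` is not totally real by
(i), so `𝒞 = f(K)`, i.e. `f(K)` is central; being maximal commutative it is then all of `End⁰(X)`.)
[cite: Zarhin2002CyclicCovers, §3 Thm 3.8 (ii) and its proof (p0008)] -/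
theorem endAlgRat_le_range_of_forall_intermediateField [IsCMField K] (hη : IsRiemannForm Φ η)
    (hmax : ∀ B ∈ endAlgRat Φ, (∀ k, B * f k = f k * B) → B ∈ Set.range f)
    (hsub : ∀ F : IntermediateField ℚ K, F ≠ ⊤ → ∀ x ∈ F, x ∈ maximalRealSubfield K)
    (hne : ∃ σ : K →+* ℂ,
      finrank ℂ ↥(⨅ y : K, Module.End.eigenspace
          ((analyticRepHom Φ ⟨f y, hf y⟩ : E →L[ℂ] E) : E →ₗ[ℂ] E) (σ y)) ≠
        finrank ℂ ↥(⨅ y : K, Module.End.eigenspace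
          ((analyticRepHom Φ ⟨f y, hf y⟩ : E →L[ℂ] E) : E →ₗ[ℂ] E)
            (NumberField.ComplexEmbedding.conjugate σ y))) :
    ∀ B ∈ endAlgRat Φ, B ∈ Set.range f := by
  classical
  obtain ⟨k₀, hk₀, hk₀'⟩ := exists_center_not_mem_maximalRealSubfield Φ f hf hη hmax hne
  -- the centre, pulled back to `K`, as an intermediate field `C`
  let f' : K →ₐ[ℚ] endAlgRat Φ := f.codRestrict (endAlgRat Φ) hf
  let C₀ : Subalgebra ℚ K := (Subalgebra.center ℚ (endAlgRat Φ)).comap f'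
  have hC₀ : ∀ k : K, k ∈ C₀ ↔ ∀ B ∈ endAlgRat Φ, B * f k = f k * B := fun k ↦ by
    change f' k ∈ Subalgebra.center ℚ (endAlgRat Φ) ↔ _
    rw [Subalgebra.mem_center_iff]
    exact ⟨fun h B hB ↦ congrArg Subtype.val (h ⟨B, hB⟩), fun h a ↦ Subtype.ext (h a.1 a.2)⟩
  let C : IntermediateField ℚ K := C₀.toIntermediateField' (Subalgebra.isField_of_algebraic C₀)
  have hC : ∀ k : K, k ∈ C ↔ ∀ B ∈ endAlgRat Φ, B * f k = f k * B := fun k ↦ by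
    rw [← hC₀]; exact Iff.rfl
  by_cases hCtop : C = ⊤
  · -- `f(K)` is central, hence `End⁰(X) ⊆ C(f(K)) = f(K)`
    intro B hB
    exact hmax B hB fun k ↦ (hC k).1 (hCtop ▸ IntermediateField.mem_top) B hB
  · exact absurd (hsub C hCtop k₀ ((hC k₀).2 hk₀)) hk₀'

end ComplexTorus

end Literature.Geometry.Kaehler

/-! ## §3 "If `p` is a Fermat prime then each subfield of `ℚ(δ_p)` distinct from `ℚ(δ_p)` itself is
totally real" — and Theorem 3.8 (ii) for `K ≅ ℚ(ζ_p)` -/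

namespace Literature.NumberTheory.NumberFields

/-- **The subfields of `ℚ(ζ_p)`, `p` a Fermat prime.** "If `p` is a Fermat prime then the only
CM-subfield of `ℚ(ζ_p)` is `ℚ(ζ_p)` itself, since the Galois group of `ℚ(ζ_p)/ℚ` is a cyclic
`2`-group, whose only element of order `2` acts as the complex conjugation. All other subfields of
`ℚ(ζ_p)` are totally real": every intermediate field `F ≠ ℚ(ζ_p)` lies in the maximal real subfield.
(Proof as printed: the fixing group `H ≠ 1` of `F` is a non-trivial `2`-group, so contains an element
of order `2` (Cauchy), which in `Gal(ℚ(ζ_p)/ℚ) ≅ (ℤ/p)^×` can only be `-1`, the complex conjugation;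
hence `F ⊆ Fix(conj) = ℚ(ζ_p)⁺`.) [cite: Zarhin2002CyclicCovers, §1 (p0001) and proof of Thm 3.8 (p0008)] -/
theorem forall_mem_maximalRealSubfield_of_ne_top_of_fermatPrime {p : ℕ} (hp : p.Prime)
    (hF : ∃ r : ℕ, p = 2 ^ 2 ^ r + 1) (K : Type*) [Field K] [NumberField K]
    [IsCyclotomicExtension {p} ℚ K] (F : IntermediateField ℚ K) (hFtop : F ≠ ⊤) :
    ∀ x ∈ F, x ∈ maximalRealSubfield K := by
  classical
  obtain ⟨r, hr⟩ := hF
  have hp2 : 2 < p := by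
    rw [hr]
    have : 2 ≤ 2 ^ 2 ^ r := by
      calc (2 : ℕ) = 2 ^ 1 := (pow_one 2).symm
        _ ≤ 2 ^ 2 ^ r := Nat.pow_le_pow_right (by norm_num) (Nat.one_le_two_pow)
    omega
  haveI : IsCMField K := IsCyclotomicExtension.Rat.isCMField K ⟨p, Set.mem_singleton p, hp2⟩
  haveI : IsGalois ℚ K := IsCyclotomicExtension.isGalois {p} ℚ K
  haveI hpf : Fact p.Prime := ⟨hp⟩
  haveI : Fact (Nat.Prime 2) := ⟨Nat.prime_two⟩
  -- complex conjugation as an element of `Gal(K/ℚ)`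
  let c : K ≃ₐ[ℚ] K := AlgEquiv.ofRingEquiv (f := (IsCMField.complexConj K).toRingEquiv) fun q ↦ by
    change IsCMField.complexConj K ((q : ℚ) : K) = ((q : ℚ) : K)
    exact map_ratCast _ q
  have hc : ∀ x, c x = IsCMField.complexConj K x := fun x ↦ rfl
  have hc2 : orderOf c = 2 := by
    refine orderOf_eq_prime ?_ ?_
    · ext x
      rw [sq, AlgEquiv.mul_apply, hc, hc, IsCMField.complexConj_apply_apply, AlgEquiv.one_apply]
    · intro h1
      apply IsCMField.complexConj_ne_one K
      ext x
      rw [← hc, h1, AlgEquiv.one_apply, AlgEquiv.one_apply]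
  -- `Gal(K/ℚ) ≅ (ℤ/p)^×` has exactly one element of order `2`
  have huniq : ∀ g : K ≃ₐ[ℚ] K, orderOf g = 2 → g = c := by
    let e := IsCyclotomicExtension.autEquivPow K (cyclotomic.irreducible_rat hp.pos)
    have key : ∀ g : K ≃ₐ[ℚ] K, orderOf g = 2 → e g = -1 := by
      intro g hg
      have h1 : orderOf (e g) = 2 := (e.orderOf_eq g).trans hg
      have hsq : ((e g : (ZMod p)ˣ) : ZMod p) * (e g : ZMod p) = 1 := by
        rw [← Units.val_mul, ← sq, ← h1, pow_orderOf_eq_one, Units.val_one]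
      rcases mul_self_eq_one_iff.1 hsq with h' | h'
      · exfalso
        have : e g = 1 := Units.ext (by rw [h', Units.val_one])
        rw [this, orderOf_one] at h1
        exact absurd h1 (by norm_num)
      · exact Units.ext (by rw [h', Units.val_neg, Units.val_one])
    intro g hg
    exact e.injective ((key g hg).trans (key c hc2).symm)
  -- the fixing group `H` of `F` is a non-trivial `2`-group
  set H := F.fixingSubgroup with hH
  have hHne : H ≠ ⊥ := by
    intro h
    apply hFtop
    rw [← IsGalois.fixedField_fixingSubgroup F, ← hH, h, IntermediateField.fixedField_bot]
  have hcardG : Nat.card (K ≃ₐ[ℚ] K) = 2 ^ 2 ^ r := by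
    rw [IsGalois.card_aut_eq_finrank, IsCyclotomicExtension.finrank K (cyclotomic.irreducible_rat hp.pos),
      Nat.totient_prime hp, hr]
    simp
  have hdvd : Nat.card H ∣ 2 ^ 2 ^ r := hcardG ▸ Subgroup.card_subgroup_dvd_card H
  obtain ⟨j, -, hjH⟩ := (Nat.dvd_prime_pow Nat.prime_two).1 hdvd
  have hj0 : j ≠ 0 := by
    rintro rfl
    rw [pow_zero] at hjH
    exact hHne (Subgroup.eq_bot_of_card_eq H hjH)
  have h2 : 2 ∣ Nat.card H := by rw [hjH]; exact dvd_pow_self 2 hj0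
  obtain ⟨h, hh⟩ := exists_prime_orderOf_dvd_card' 2 h2
  -- its element of order `2` is complex conjugation, so `F ⊆ Fix(c) = K⁺`
  have hcH : c ∈ H := by
    have : (h : K ≃ₐ[ℚ] K) = c := huniq _ (by rw [Subgroup.orderOf_coe]; exact hh)
    rw [← this]
    exact h.2
  intro x hx
  have hx' : x ∈ IntermediateField.fixedField H := by
    rw [hH, IsGalois.fixedField_fixingSubgroup]; exact hx
  have hfix : c x = x := (IntermediateField.mem_fixedField_iff H x).1 hx' c hcH
  rw [hc] at hfix
  exact (IsCMField.complexConj_eq_self_iff K x).1 hfix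

end Literature.NumberTheory.NumberFields

namespace Literature.Geometry.Kaehler

namespace ComplexTorus

variable {ι : Type*} [Fintype ι] [DecidableEq ι] {E : Type*} [NormedAddCommGroup E] [NormedSpace ℂ E]
  [FiniteDimensional ℂ E] (Φ : (ι → ℝ) ≃L[ℝ] E) {η : E [⋀^Fin 2]→L[ℝ] ℝ}
  {K : Type*} [Field K] [NumberField K] (f : K →ₐ[ℚ] Matrix ι ι ℚ) (hf : ∀ x, f x ∈ endAlgRat Φ)

/-- **Theorem 3.8 (ii) at torus level: "If `p` is a Fermat prime then `End⁰(J^{(f,p)}) = ℚ(δ_p) ≅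
ℚ(ζ_p)`."** For a polarised complex torus `(X, η)` with the `p`-th cyclotomic field `K ≅ ℚ(ζ_p)`,
`p = 2^{2^r} + 1` a Fermat prime, embedded `f : K ↪ End⁰(X)` as a maximal commutative subalgebra, and
one pair of tangent multiplicities `n_σ ≠ n_σ̄` (the [Koo] Th. 3 eigenvector count of the printed proof,
taken as hypothesis), every endomorphism is in `f(K)`: `End⁰(X) = f(K)`.
[cite: Zarhin2002CyclicCovers, §3 Thm 3.8 (ii) (p0008); §1 Thm 1.1, second clause (p0001)] -/
theorem endAlgRat_le_range_of_fermatPrime {p : ℕ} (hp : p.Prime) (hF : ∃ r : ℕ, p = 2 ^ 2 ^ r + 1)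
    [IsCyclotomicExtension {p} ℚ K] (hη : IsRiemannForm Φ η)
    (hmax : ∀ B ∈ endAlgRat Φ, (∀ k, B * f k = f k * B) → B ∈ Set.range f)
    (hne : ∃ σ : K →+* ℂ,
      finrank ℂ ↥(⨅ y : K, Module.End.eigenspace
          ((analyticRepHom Φ ⟨f y, hf y⟩ : E →L[ℂ] E) : E →ₗ[ℂ] E) (σ y)) ≠
        finrank ℂ ↥(⨅ y : K, Module.End.eigenspace
          ((analyticRepHom Φ ⟨f y, hf y⟩ : E →L[ℂ] E) : E →ₗ[ℂ] E)
            (NumberField.ComplexEmbedding.conjugate σ y))) :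
    ∀ B ∈ endAlgRat Φ, B ∈ Set.range f := by
  obtain ⟨r, hr⟩ := hF
  have hp2 : 2 < p := by
    rw [hr]
    have : 2 ≤ 2 ^ 2 ^ r := by
      calc (2 : ℕ) = 2 ^ 1 := (pow_one 2).symm
        _ ≤ 2 ^ 2 ^ r := Nat.pow_le_pow_right (by norm_num) (Nat.one_le_two_pow)
    omega
  haveI : IsCMField K := IsCyclotomicExtension.Rat.isCMField K ⟨p, Set.mem_singleton p, hp2⟩
  exact endAlgRat_le_range_of_forall_intermediateField Φ f hf hη hmax
    (Literature.NumberTheory.NumberFields.forall_mem_maximalRealSubfield_of_ne_top_of_fermatPrime hp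
      ⟨r, hr⟩ K) hne


/-- **Theorem 3.8 (ii) for `δ ∈ End(X)` with `Φ_p(δ) = 0`: `End⁰(X) = ℚ[δ]` and "therefore
`End(X) = ℤ[δ] ≅ ℤ[ζ_p]`".** Let `(X, η)` be a polarised complex torus of positive dimension,
`p = 2^{2^r} + 1` a Fermat prime, `δ = D ∈ End(X)` an integer matrix with `Φ_p(D) = 0`, such that
`ℚ[δ]` is a maximal commutative subalgebra of `End⁰(X)` (every endomorphism commuting with `δ` is a
rational polynomial in `δ`), and suppose one eigenvalue `μ` of `ρ_a(δ)` on `T₀X` has a multiplicity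
different from that of `μ̄` (the curve-side [Koo] count of the printed proof, as hypothesis). Then every
element of `End⁰(X)` is a rational polynomial in `δ`, and every element of `End(X)` an INTEGER
polynomial in `δ` ("`ℤ[δ_p] ≅ ℤ[ζ_p]` is the ring of integers", this seat's
`exists_eq_aeval_of_isIntegral`). The cyclotomic field `ℚ(ζ_p)` is realised as `CyclotomicField p ℚ`,
embedded by `ζ_p ↦ δ`. [cite: Zarhin2002CyclicCovers, §3 Thm 3.8 (ii) (p0008); §1 Thm 1.1 ("If `p` is a Fermat prime … `End(J^{(f,p)}) = ℤ[δ_p] ≅ ℤ[ζ_p]`", p0001)] -/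
theorem endRingInt_le_adjoin_of_fermatPrime [Nonempty ι] {p : ℕ} (hp : p.Prime)
    (hF : ∃ r : ℕ, p = 2 ^ 2 ^ r + 1) (hη : IsRiemannForm Φ η) {D : Matrix ι ι ℤ}
    (hD : aeval D (cyclotomic p ℤ) = 0) (hDe : D ∈ endRingInt Φ)
    (hmax : ∀ B ∈ endAlgRat Φ, B * D.map (Int.cast : ℤ → ℚ) = D.map (Int.cast : ℤ → ℚ) * B →
      B ∈ Algebra.adjoin ℚ ({D.map (Int.cast : ℤ → ℚ)} : Set (Matrix ι ι ℚ)))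
    (hne : ∃ μ : ℂ,
      finrank ℂ ↥(Module.End.eigenspace ((analyticRepHom Φ ⟨D.map (Int.cast : ℤ → ℚ),
          (mem_endRingInt_iff Φ).1 hDe⟩ : E →L[ℂ] E) : E →ₗ[ℂ] E) μ) ≠
        finrank ℂ ↥(Module.End.eigenspace ((analyticRepHom Φ ⟨D.map (Int.cast : ℤ → ℚ),
          (mem_endRingInt_iff Φ).1 hDe⟩ : E →L[ℂ] E) : E →ₗ[ℂ] E) (conj μ))) :
    (∀ B ∈ endAlgRat Φ, B ∈ Algebra.adjoin ℚ ({D.map (Int.cast : ℤ → ℚ)} : Set (Matrix ι ι ℚ))) ∧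
      ∀ U ∈ endRingInt Φ, U ∈ Algebra.adjoin ℤ ({D} : Set (Matrix ι ι ℤ)) := by
  classical
  haveI : Fact p.Prime := ⟨hp⟩
  haveI : NeZero p := ⟨hp.ne_zero⟩
  set Dq : Matrix ι ι ℚ := D.map (Int.cast : ℤ → ℚ) with hDqdef
  have hDq : Dq ∈ endAlgRat Φ := (mem_endRingInt_iff Φ).1 hDe
  have hDq0 : aeval Dq (cyclotomic p ℚ) = 0 := aeval_map_cyclotomic_eq_zero hD
  -- the cyclotomic field `K = ℚ(ζ_p)` and its embedding `ζ ↦ δ`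
  let K := CyclotomicField p ℚ
  haveI : IsCyclotomicExtension {p} ℚ K := CyclotomicField.isCyclotomicExtension p ℚ
  let ζ : K := IsCyclotomicExtension.zeta p ℚ K
  have hζ : IsPrimitiveRoot ζ p := IsCyclotomicExtension.zeta_spec p ℚ K
  have hmin : minpoly ℚ ζ = cyclotomic p ℚ := (cyclotomic_eq_minpoly_rat hζ hp.pos).symm
  let pb : PowerBasis ℚ K := hζ.powerBasis ℚ
  have hpb : pb.gen = ζ := IsPrimitiveRoot.powerBasis_gen ℚ hζ
  have hgen : aeval Dq (minpoly ℚ pb.gen) = 0 := by rw [hpb, hmin]; exact hDq0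
  let f : K →ₐ[ℚ] Matrix ι ι ℚ := pb.lift Dq hgen
  have hfζ : f ζ = Dq := by rw [← hpb]; exact pb.lift_gen Dq hgen
  -- `f(K) = ℚ[δ]`
  have hrange : f.range = Algebra.adjoin ℚ ({Dq} : Set (Matrix ι ι ℚ)) := by
    rw [← Algebra.map_top, ← IsCyclotomicExtension.adjoin_primitive_root_eq_top hζ, AlgHom.map_adjoin,
      Set.image_singleton, hfζ]
  have hf : ∀ x, f x ∈ endAlgRat Φ := fun x ↦ by
    have hx : f x ∈ Algebra.adjoin ℚ ({Dq} : Set (Matrix ι ι ℚ)) := hrange ▸ f.mem_range_self x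
    exact (Algebra.adjoin_le (Set.singleton_subset_iff.2 hDq) : _ ≤ endAlgRat Φ) hx
  have hmax' : ∀ B ∈ endAlgRat Φ, (∀ k, B * f k = f k * B) → B ∈ Set.range f := fun B hB hc ↦ by
    have h := hmax B hB (by rw [← hfζ]; exact hc ζ)
    rw [← hrange, AlgHom.mem_range] at h
    exact h
  -- the multiplicity hypothesis, read on an embedding `σ : K ↪ ℂ` with `σ ζ = μ`
  have hζtop : ℚ⟮ζ⟯ = ⊤ :=
    (IntermediateField.adjoin_simple_eq_top_iff_of_isAlgebraic
      (Algebra.IsAlgebraic.isAlgebraic ζ)).2 (IsCyclotomicExtension.adjoin_primitive_root_eq_top hζ)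
  have hne' : ∃ σ : K →+* ℂ,
      finrank ℂ ↥(⨅ y : K, Module.End.eigenspace
          ((analyticRepHom Φ ⟨f y, hf y⟩ : E →L[ℂ] E) : E →ₗ[ℂ] E) (σ y)) ≠
        finrank ℂ ↥(⨅ y : K, Module.End.eigenspace
          ((analyticRepHom Φ ⟨f y, hf y⟩ : E →L[ℂ] E) : E →ₗ[ℂ] E)
            (NumberField.ComplexEmbedding.conjugate σ y)) := by
    obtain ⟨μ, hμ⟩ := hne
    have hρ : ((analyticRepHom Φ ⟨Dq, (mem_endRingInt_iff Φ).1 hDe⟩ : E →L[ℂ] E) : E →ₗ[ℂ] E) =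
        ((analyticRepHom Φ ⟨f ζ, hf ζ⟩ : E →L[ℂ] E) : E →ₗ[ℂ] E) := by
      congr 2
      exact Subtype.ext hfζ.symm
    rw [hρ] at hμ
    -- `μ` (or `μ̄`, hence `μ`) is a primitive `p`-th root of unity: otherwise both eigenspaces vanish
    have hprim : IsPrimitiveRoot μ p := by
      by_contra hμp
      have hμp' : ¬ IsPrimitiveRoot (conj μ) p := fun h ↦ by
        have h' := h.map_of_injective (f := starRingEnd ℂ) (RingHom.injective _)
        rw [starRingEnd_self_apply] at h'
        exact hμp h'
      have hvan : ∀ ν : ℂ, ¬ IsPrimitiveRoot ν p →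
          Module.End.eigenspace ((analyticRepHom Φ ⟨f ζ, hf ζ⟩ : E →L[ℂ] E) : E →ₗ[ℂ] E) ν = ⊥ := by
        intro ν hν
        refine eigenspace_analyticRepHom_eq_bot Φ f hf ζ ?_
        rw [hmin]
        intro h0
        apply hν
        rwa [aeval_def, eval₂_eq_eval_map, map_cyclotomic, ← IsRoot.def, isRoot_cyclotomic_iff] at h0
      apply hμ
      rw [hvan μ hμp, hvan (conj μ) hμp']
    have hgenμ : aeval μ (minpoly ℚ pb.gen) = 0 := by
      rw [hpb, hmin, aeval_def, eval₂_eq_eval_map, map_cyclotomic, ← IsRoot.def, isRoot_cyclotomic_iff]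
      exact hprim
    let σ : K →ₐ[ℚ] ℂ := pb.lift μ hgenμ
    have hσζ : σ ζ = μ := by rw [← hpb]; exact pb.lift_gen μ hgenμ
    refine ⟨(σ : K →+* ℂ), ?_⟩
    rw [iInf_eigenspace_analyticRepHom_eq_eigenspace Φ f hf hζtop (σ : K →+* ℂ),
      iInf_eigenspace_analyticRepHom_eq_eigenspace Φ f hf hζtop
        (NumberField.ComplexEmbedding.conjugate (σ : K →+* ℂ)),
      NumberField.ComplexEmbedding.conjugate_coe_eq]
    change finrank ℂ ↥(Module.End.eigenspace _ (σ ζ)) ≠ finrank ℂ ↥(Module.End.eigenspace _ (conj (σ ζ)))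
    rw [hσζ]
    exact hμ
  -- (ii): `End⁰(X) = f(K) = ℚ[δ]`
  have hii := endAlgRat_le_range_of_fermatPrime Φ f hf hp hF hη hmax' hne'
  have hiiq : ∀ B ∈ endAlgRat Φ, B ∈ Algebra.adjoin ℚ ({Dq} : Set (Matrix ι ι ℚ)) := fun B hB ↦ by
    obtain ⟨k, rfl⟩ := hii B hB
    rw [← hrange]; exact f.mem_range_self k
  refine ⟨hiiq, fun U hU ↦ ?_⟩
  -- "therefore `End(X) = ℤ[δ]`": integral elements of `ℚ[δ]` are integer polynomials in `δ`
  have hUq : U.map (Int.cast : ℤ → ℚ) ∈ Algebra.adjoin ℚ ({Dq} : Set (Matrix ι ι ℚ)) :=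
    hiiq _ ((mem_endRingInt_iff Φ).1 hU)
  have hint : IsIntegral ℤ (U.map (Int.cast : ℤ → ℚ)) :=
    IsIntegral.map ((Int.castRingHom ℚ).mapMatrix : Matrix ι ι ℤ →+* Matrix ι ι ℚ).toIntAlgHom
      (Algebra.IsIntegral.isIntegral (R := ℤ) U)
  obtain ⟨P, hP⟩ := exists_eq_aeval_of_isIntegral hp hD hUq hint
  have hUP : U = aeval D P :=
    Matrix.map_injective (f := (Int.cast : ℤ → ℚ)) Int.cast_injective hP
  rw [hUP]
  exact aeval_mem_adjoin_singleton ℤ D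

end ComplexTorus

end Literature.Geometry.Kaehler
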